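/-
Copyright (c) 2026 the pub-hodgecm-mathlib formalisation cell (harness21).  Prover seat hodgecm-mathlib-LH7-p02 (g6): LH4-plan (g6) price-list offer (P8c)
«C-Δram AT ANY NON-SPLIT PLACE» — the de-`h2` twin of ★ row «C-Δram» `FinExplicitTransferFactorCayleyShiftRamified` §1 (F0P3b-p01 (g12)) over ★ (P8b)
`FinExplicitTransferFactorDeepTauAnyPlacePairs`; 2026-09-02.
-/
import Literature.NumberTheory.Rogawski1990.FinExplicitTransferFactorDeepTauAnyPlacePairs   -- ★ (P8b): `exists_forall_finExplicitDelta_eq_hilbertSymbol_mul_of_deep_anyPlace`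
import Literature.NumberTheory.Rogawski1990.FinExplicitTransferFactorCayleyShiftRamified    -- ★ row «C-Δram» (TAME): §2 `hilbertSymbol_eq_of_mul_sq_eq_mul`, §3 `moebiusShift_dischargers`; brings ★ `finKappaAt_eq_of_shared_eigenvector`
import HarnessLib

/-!
# `Δ‴_v(γ_H, γ′) = q_v⁻² · Δ‴_v(u_H, u′)` under a two-step drop of the depth token at ANY non-split place (dyadic included)
# (Rogawski 1990 §4.9 Prop. 4.9.1; Kottwitz 1986 §3)

Topic `NumberTheory/Rogawski1990`; namespace `Literature.NumberTheory.Rogawski1990`.  THEOREMS ONLY (no definition, no instance, no notation, no named fact, no `sorry`);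
kernel lane `--supports stmt-HodgeConjecture-24833`.  Cell `pub/hodgecm-mathlib` (D-0151), crux H413 = `stmt-HodgeConjecture-24833`; half A line LH4 (dyadic pay-down),
LH4-plan (g6) price list, item **(P8c)** = row «C-Δram AT ANY NON-SPLIT PLACE» ((D-RAM)∕M5 column of LH5-p01 (g5)'s census `CENSUS-DRAM-h2.v1` 3989fe6bdd514291 §1∕§3): ★ row «C-Δram» §1 `exists_forall_finExplicitDelta_eq_inv_sq_mul_of_hilbertSymbol_eq (h2 : |2|_w = 1)` with the binder
`h2` DELETED, token for token otherwise — its proof is the ★ one with the TAME Pairs head replaced by the any-place head ★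
`exists_forall_finExplicitDelta_eq_hilbertSymbol_mul_of_deep_anyPlace` ((P8b) part II) and the place-free ★ `finKappaAt_eq_of_shared_eigenvector`.  The Hilbert-symbol
discharger ★ §2 `hilbertSymbol_eq_of_mul_sq_eq_mul` (`|ε − 1|_v < |4|_v`) is already dyadic-correct; the scalar dischargers ★ §3 `moebiusShift_dischargers` keep their
`|2| = 1` binder (their dyadic twin needs `|4|`-deeper inputs and the sharper output `|ε − 1| < |4|`; not in this file).  HONEST LABEL: HC_CM is proved only modulo the
7 printed citations (2 remaining named inputs: hLiu418 = stmt-HodgeConjecture-24832, h413 = stmt-HodgeConjecture-24833) until rung 0 closes; count-neutral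
((D-RAM)∕(D-UNR) stay PRINT; pays no organ, opens no road); the TAME head is the case `ord_v 2 = 0` and is NOT restated.

## References
* [Rogawski1990] J. D. Rogawski, *Automorphic Representations of Unitary Groups in Three Variables*, Ann. of Math. Stud. 123 (1990): §4.9 p. 55, Prop. 4.9.1 (a)(b);
  §4.3 (4.3.2) p. 43; Prop. 8.1.3 p. 116.
* [Kottwitz1986] R. E. Kottwitz, *Base change for unit elements of Hecke algebras*, Compositio Math. 60 (1986): §3.
-/

set_option autoImplicit false

noncomputable section

open NumberField IsDedekindDomain Filter Topology Matrix
open scoped WithZero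

namespace Literature.NumberTheory.Rogawski1990

open Literature.NumberTheory.Automorphic Literature.NumberTheory.Automorphic.UnitaryGroup Literature.NumberTheory.GaloisRepresentations
open Literature.NumberTheory.QuadraticForms

/-! ## §1 The shift law in `(β, m)`-currency at any non-split place -/

open scoped Classical in
/-- **ROW «C-Δram AT ANY NON-SPLIT PLACE» ((D-RAM)∕M5 column, LH5-p01 census 3989fe6b §3): `Δ‴_v(γ_H, γ′) = q_v⁻² · Δ‴_v(u_H, u′)`, dyadic places included** (★ row «C-Δram» with its binder `h2 : |2|_w = 1` DELETED; `q_v = #k_v`): there is a deepness exponent `M₀ ≥ 1` (the any-place τ-head's, ★ `FinExplicitTransferFactorDeepTauAnyPlacePairs`: level `M₀ + ord_v 2`) such that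
for `γ_H, u_H` both `M₀`-deep, with depth tokens `|χ_g(u)_w|_w = |ι_w ϖ_v|_w^m`, `|χ_{g′}(u′)_w|_w = |ι_w ϖ_v|_w^{m′}`, `m = m′ + 2`, symmetrised discriminants `β, β′`
with `(β, θ)_v = (β′, θ)_v`, and matched `γ′ ↔ ι_v(γ_H)`, `u′ ↔ ι_v(u_H)` sharing a non-zero vector `p′` on the `u`-eigenlines: `Δ‴_v(γ_H, γ′) = q_v⁻²·Δ‴_v(u_H, u′)`
(★ `exists_forall_finExplicitDelta_eq_hilbertSymbol_mul_of_deep_anyPlace` on both sides, ★ `finKappaAt_eq_of_shared_eigenvector`).  No `hunr`, no hypothesis on `μ_w`.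
[cite: Rogawski1990, §4.9 p. 55, Prop. 4.9.1 (a)(b); §4.3 (4.3.2) p. 43] [cite: Kottwitz1986, §3] -/
theorem exists_forall_finExplicitDelta_eq_inv_sq_mul_of_hilbertSymbol_eq_anyPlace
    (L : Type) [Field L] [NumberField L] [IsCMField L] (v : HeightOneSpectrum (𝓞 ↥(maximalRealSubfield L)))
    (w : PlacesOver L v) (hw : IsCMField.complexConj L • w.1 = w.1) (μ : HeckeCharacter L)
    (hμω : ∀ x : ideleGroup ↥(maximalRealSubfield L), μ (AdeleRing.ideleBaseChange ↥(maximalRealSubfield L) L x) = quadraticHeckeCharCM L x)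
    (H' : Matrix (Fin 3) (Fin 3) L) :
    ∃ M₀ : ℕ, 1 ≤ M₀ ∧
      ∀ (γH uH : (cmDatum L 2 (Matrix.of fun i j : Fin 2 => if i.val + j.val + 1 = 2 then (1 : L) else 0)).Local v ×
          (cmDatum L 1 (Matrix.of fun i j : Fin 1 => if i.val + j.val + 1 = 1 then (1 : L) else 0)).Local v) (m m' : ℕ)
        (γ' u' : (cmDatum L 3 H').Local v),
        -- depth tokens, two steps apart
        Valued.v (((finCharpolyTwo L v γH).eval (finGammaTwo L v γH)) w) =
          Valued.v ((toPlace v w (HeckeCharacter.uniformizer ↥(maximalRealSubfield L) v : v.adicCompletion ↥(maximalRealSubfield L))) ^ m) →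
        Valued.v (((finCharpolyTwo L v uH).eval (finGammaTwo L v uH)) w) =
          Valued.v ((toPlace v w (HeckeCharacter.uniformizer ↥(maximalRealSubfield L) v : v.adicCompletion ↥(maximalRealSubfield L))) ^ m') →
        m = m' + 2 →
        -- both elements deep
        Valued.v (finGammaTwo L v γH w - 1) ≤
          Valued.v ((toPlace v w (HeckeCharacter.uniformizer ↥(maximalRealSubfield L) v : v.adicCompletion ↥(maximalRealSubfield L))) ^ M₀) →
        Valued.v (((γH.1.val.val : Matrix (Fin 2) (Fin 2) (LocalRing L v)).map
            (Pi.evalRingHom (fun w' : PlacesOver L v => w'.1.adicCompletion L) w)).det - 1) ≤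
          Valued.v ((toPlace v w (HeckeCharacter.uniformizer ↥(maximalRealSubfield L) v : v.adicCompletion ↥(maximalRealSubfield L))) ^ M₀) →
        Valued.v (finGammaTwo L v uH w - 1) ≤
          Valued.v ((toPlace v w (HeckeCharacter.uniformizer ↥(maximalRealSubfield L) v : v.adicCompletion ↥(maximalRealSubfield L))) ^ M₀) →
        Valued.v (((uH.1.val.val : Matrix (Fin 2) (Fin 2) (LocalRing L v)).map
            (Pi.evalRingHom (fun w' : PlacesOver L v => w'.1.adicCompletion L) w)).det - 1) ≤
          Valued.v ((toPlace v w (HeckeCharacter.uniformizer ↥(maximalRealSubfield L) v : v.adicCompletion ↥(maximalRealSubfield L))) ^ M₀) →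
        -- the symmetrised discriminants and the Hilbert-symbol match
        ∀ β β' : (v.adicCompletion ↥(maximalRealSubfield L))ˣ,
          toPlace v w (β : v.adicCompletion ↥(maximalRealSubfield L)) =
            -(((finCharpolyTwo L v γH).eval (finGammaTwo L v γH)) w *
                (finGammaTwo L v γH w ^ 2 +
                  ((γH.1.val.val : Matrix (Fin 2) (Fin 2) (LocalRing L v)).map (Pi.evalRingHom (fun w' : PlacesOver L v => w'.1.adicCompletion L) w)).det)) /
              (2 * finGammaTwo L v γH w ^ 2 *
                ((γH.1.val.val : Matrix (Fin 2) (Fin 2) (LocalRing L v)).map (Pi.evalRingHom (fun w' : PlacesOver L v => w'.1.adicCompletion L) w)).det) →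
          toPlace v w (β' : v.adicCompletion ↥(maximalRealSubfield L)) =
            -(((finCharpolyTwo L v uH).eval (finGammaTwo L v uH)) w *
                (finGammaTwo L v uH w ^ 2 +
                  ((uH.1.val.val : Matrix (Fin 2) (Fin 2) (LocalRing L v)).map (Pi.evalRingHom (fun w' : PlacesOver L v => w'.1.adicCompletion L) w)).det)) /
              (2 * finGammaTwo L v uH w ^ 2 *
                ((uH.1.val.val : Matrix (Fin 2) (Fin 2) (LocalRing L v)).map (Pi.evalRingHom (fun w' : PlacesOver L v => w'.1.adicCompletion L) w)).det) →
          hilbertSymbol (v.adicCompletion ↥(maximalRealSubfield L)) (β : v.adicCompletion ↥(maximalRealSubfield L))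
              (algebraMap ↥(maximalRealSubfield L) _ ((cmQuadraticGenerator L : 𝓞 ↥(maximalRealSubfield L)) : ↥(maximalRealSubfield L))) =
            hilbertSymbol (v.adicCompletion ↥(maximalRealSubfield L)) (β' : v.adicCompletion ↥(maximalRealSubfield L))
              (algebraMap ↥(maximalRealSubfield L) _ ((cmQuadraticGenerator L : 𝓞 ↥(maximalRealSubfield L)) : ↥(maximalRealSubfield L))) →
        -- matched pairs sharing an eigenvector on the `u`-eigenlines
        IsLocalNormPair L H' v γH γ' → IsLocalNormPair L H' v uH u' →
        ∀ {p' : Fin 3 → LocalRing L v}, p' ≠ 0 →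
          (γ'.val.val : Matrix (Fin 3) (Fin 3) (LocalRing L v)) *ᵥ p' = finGammaTwo L v γH • p' →
          (u'.val.val : Matrix (Fin 3) (Fin 3) (LocalRing L v)) *ᵥ p' = finGammaTwo L v uH • p' →
        finExplicitDelta L v H' γH μ γ' = (((Nat.card (𝓞 ↥(maximalRealSubfield L) ⧸ v.asIdeal) : ℂ)) ^ 2)⁻¹ * finExplicitDelta L v H' uH μ u' := by
  classical
  obtain ⟨M₀, hM₁, h⟩ := exists_forall_finExplicitDelta_eq_hilbertSymbol_mul_of_deep_anyPlace L v w hw μ hμω H'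
  refine ⟨M₀, hM₁, fun γH uH m m' γ' u' hχ hχ' hmm hud hdd hud' hdd' β β' hβ hβ' hββ' hpair hpair' p' hne hp hp' => ?_⟩
  have hvs : Subsingleton (PlacesOver L v) := PlacesOver.subsingleton_of_smul_eq (IsCMField.complexConj L) (IsCMField.complexConj_ne_one L) w hw
  have hϖ0 : (toPlace v w (HeckeCharacter.uniformizer ↥(maximalRealSubfield L) v : v.adicCompletion ↥(maximalRealSubfield L))) ≠ 0 :=
    toPlace_heckeUniformizer_ne_zero L v w
  -- the `χ`-values are units (non-zero at the one place `w`)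
  have hunit : ∀ {x : LocalRing L v} {n : ℕ}, Valued.v (x w) =
      Valued.v ((toPlace v w (HeckeCharacter.uniformizer ↥(maximalRealSubfield L) v : v.adicCompletion ↥(maximalRealSubfield L))) ^ n) → IsUnit x := by
    intro x n hx
    have hx0 : x w ≠ 0 := fun h0 => by
      rw [h0, map_zero] at hx
      exact (Valuation.ne_zero_iff _).2 (pow_ne_zero n hϖ0) hx.symm
    exact isUnit_localRing_of_ne_zero_of_subsingleton L v hvs fun h0 => hx0 (by rw [h0, Pi.zero_apply])
  have hκ := finKappaAt_eq_of_shared_eigenvector L v H' w hw hpair hpair' (hunit hχ) (hunit hχ') hne hp hp'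
  have hq0 : 0 < Nat.card (𝓞 ↥(maximalRealSubfield L) ⧸ v.asIdeal) := Nat.card_pos
  have hq : ((Nat.card (𝓞 ↥(maximalRealSubfield L) ⧸ v.asIdeal) : ℂ)) ≠ 0 := by exact_mod_cast hq0.ne'
  rw [h γH m γ' hχ hud hdd β hβ hpair, h uH m' u' hχ' hud' hdd' β' hβ' hpair', hββ', hκ, hmm, pow_add]
  field_simp

end Literature.NumberTheory.Rogawski1990

end
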